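/-
Copyright (c) 2026 the pub-hodgecm-mathlib formalisation cell (harness21).  Prover seat hodgecm-mathlib-F0P2-p01 (g26); E1 ledger row 45 «(SS-E) SECOND EQUALITY»
(E1 keeper ∕ dealer F0P3a-p03 (g29) 01:55:43Z ∕ 01:58:59Z ∕ 02:36:24Z «45 (F0P2-p01)»; CHARTER-TEST v0 spec field 5); 2026-09-03.
-/
import Literature.NumberTheory.Automorphic.CompactInductionFrobenius   -- ★ C-IND FROBENIUS `exists_linearEquiv_intertwiningMap_cIndRep`
import Mathlib.RepresentationTheory.Basic
import Mathlib.Algebra.DirectSum.Module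
import Mathlib.LinearAlgebra.Dimension.Constructions
import HarnessLib

/-!
# Frobenius reciprocity for a direct sum of compact inductions, and the Euler–Poincaré regrouping
# `Σᵢ (−1)^{dᵢ} dim Hom_{Pᵢ}(τᵢ, ρ|) = Σ_q (−1)^q dim Hom_G(C_q, ρ)`, `C_q = ⊕_{dᵢ = q} c-Ind_{Pᵢ}^G τᵢ` (Schneider–Stuhler 1997 III.4)

Topic `NumberTheory/Automorphic`; namespace `Representation`.  THEOREMS ONLY (no definition, no instance, no notation, no named fact, no `sorry`).
The direct sum of a family of representations is Mathlib's `Representation.directSum` (on `⨁ i, M i`, any index type); its source-side universal property for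
intertwining maps (§1) is the `DirectSum` analogue of ★ `Representation.IntertwiningMap.piLeftLinearEquiv` (finite families on `Π j, C j`, `Literature.RepresentationTheory.FiniteGroups`),
stated here universe-polymorphically and without finiteness; transport along an equivalence of sources is ★ `Representation.IntertwiningMap.congrLeft` (not repeated).

* §1 **`Hom_G(⨁ᵢ Vᵢ, ρ) ≃ₗ[k] Πᵢ Hom_G(Vᵢ, ρ)`** by restriction to the summands (`exists_linearEquiv_intertwiningMap_directSum_pi`; inverse = `DirectSum.toModule`); finiteness and
  `finrank k Hom_G(⨁ᵢ Vᵢ, ρ) = Σᵢ finrank k Hom_G(Vᵢ, ρ)` for a finite family with finite-dimensional Hom-spaces.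
* §2 **`finrank k Hom_G(c-Ind_H^G σ, π) = finrank k Hom_H(σ, π|_H)`** for `H` open, `σ` smooth — the dimension form of ★ C-IND FROBENIUS (+ transfer of finite-dimensionality).
* §3 families: `Hom_G(⨁ᵢ c-Ind_{Pᵢ}^G τᵢ, ρ) ≃ₗ[k] Πᵢ Hom_{Pᵢ}(τᵢ, ρ|_{Pᵢ})` and `finrank k Hom_G(⨁ᵢ c-Ind τᵢ, ρ) = Σᵢ finrank k Hom_{Pᵢ}(τᵢ, ρ|_{Pᵢ})`.
* §4 **THE (SS-E) SECOND EQUALITY** `alternatingSum_finrank_intertwiningMap_eq_sum_directSum_cIndRep`: for a finite family `i ∈ s` of OPEN subgroups `Pᵢ`, SMOOTH `τᵢ` and degrees `dᵢ`,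
  `Σ_{i ∈ s} (−1)^{dᵢ} finrank Hom_{Pᵢ}(τᵢ, ρ|_{Pᵢ}) = Σ_{q ∈ d(s)} (−1)^q finrank Hom_G(C_q, ρ)` with the `q`-CHAINS `C_q := ⨁_{i ∈ s, dᵢ = q} c-Ind_{Pᵢ}^G τᵢ` — the step
  «`Σ_F (−1)^{dim F} dim Hom_{P_F}(V^{U_F}, ρ) = Σ_q (−1)^q dim Hom_G(C_q^{or}(X; γ_e(V)), ρ)`» of [SchneiderStuhler1997, III.4] once the chain spaces are written as sums of compact
  inductions over simplex representatives (valued in any commutative ring `R`, e.g. `ℂ` as in ★ row 42 `smoothTrace_epFunction`, or `ℤ`).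
Consumer (cell `pub/hodgecm-mathlib`, crux H413, E1): with ★ row 42 (FIRST equality `tr ρ(f_EP) = Σᵢ (−1)^{dᵢ} mᵢ`) this gives `tr ρ(f_EP^{V,e}) = Σ_q (−1)^q dim Hom_G(C_q, ρ)`; the last
step to `EP(V, ρ) = Σ_q (−1)^q dim Ext^q_G(V, ρ)` (projectivity of the `C_q`, exactness of the resolution) is NOT here.  HONEST LABEL: count-neutral generic base layer; E1 = PRINT
until the charter test; HC_CM is proved only modulo the printed citations until rung 0 closes.

## References
* [SchneiderStuhler1997] P. Schneider, U. Stuhler, *Representation theory and sheaves on the Bruhat–Tits building*, Publ. Math. IHÉS 85 (1997), §III.4 (Euler–Poincaré functions;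
  `tr π′(f_EP^π) = Σ_q (−1)^q dim Hom_G(C_q, π′)`).
* [BushnellHenniart2006] C. J. Bushnell, G. Henniart, *The local Langlands conjecture for GL(2)*, §2.5 (Frobenius reciprocity for compact induction from an open subgroup).
* [Bump1997] D. Bump, *Automorphic Forms and Representations* (1997), Exercise 4.5.5.
-/

set_option autoImplicit false

noncomputable section

open DirectSum

namespace Representation

/-! ## §1 Intertwining maps out of a direct sum of representations -/

section DirectSumSource

variable {k G : Type*} [CommRing k] [Group G] {ι : Type*} {M : ι → Type*} [∀ i, AddCommGroup (M i)] [∀ i, Module k (M i)]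
  {N : Type*} [AddCommGroup N] [Module k N]

/-- **`Hom_G(⨁ᵢ Vᵢ, ρ) ≃ₗ[k] Πᵢ Hom_G(Vᵢ, ρ)`**: restriction of an intertwining map `T : ⨁ᵢ Vᵢ → ρ` to the summands (`(e T)ᵢ x = T (lof i x)`), with inverse the universal map
`DirectSum.toModule` of a family, which is `G`-equivariant because `g` acts summand-wise.  Any index type. [cite: SchneiderStuhler1997, §III.4] -/
theorem exists_linearEquiv_intertwiningMap_directSum_pi [DecidableEq ι] (V : ∀ i, Representation k G (M i)) (ρ : Representation k G N) :
    ∃ e : (Representation.directSum V).IntertwiningMap ρ ≃ₗ[k] (Π i, (V i).IntertwiningMap ρ),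
      ∀ (T : (Representation.directSum V).IntertwiningMap ρ) (i : ι) (x : M i), e T i x = T (DirectSum.lof k ι M i x) := by
  -- `g` acts on the summand `i` through `V i`
  have hlof : ∀ (i : ι) (g : G) (x : M i), Representation.directSum V g (DirectSum.lof k ι M i x) = DirectSum.lof k ι M i (V i g x) := by
    intro i g x
    rw [Representation.directSum_apply, DirectSum.lmap_lof]
  -- restriction to the summands
  let res : (Representation.directSum V).IntertwiningMap ρ →ₗ[k] (Π i, (V i).IntertwiningMap ρ) :=
    { toFun := fun T i =>
        { toLinearMap := T.toLinearMap ∘ₗ DirectSum.lof k ι M i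
          isIntertwining' := fun g => LinearMap.ext fun x => by
            change T (DirectSum.lof k ι M i (V i g x)) = ρ g (T (DirectSum.lof k ι M i x))
            rw [← hlof, T.isIntertwining] }
      map_add' := fun T T' => funext fun i => IntertwiningMap.ext (LinearMap.ext fun x => rfl)
      map_smul' := fun c T => funext fun i => IntertwiningMap.ext (LinearMap.ext fun x => rfl) }
  -- extension of a family by the universal property
  let ext' : (Π i, (V i).IntertwiningMap ρ) → (Representation.directSum V).IntertwiningMap ρ := fun φ =>
    { toLinearMap := DirectSum.toModule k ι N fun i => (φ i).toLinearMap
      isIntertwining' := fun g => DirectSum.linearMap_ext k fun i => LinearMap.ext fun x => by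
        change DirectSum.toModule k ι N (fun i => (φ i).toLinearMap) (Representation.directSum V g (DirectSum.lof k ι M i x)) =
          ρ g (DirectSum.toModule k ι N (fun i => (φ i).toLinearMap) (DirectSum.lof k ι M i x))
        rw [hlof, DirectSum.toModule_lof, DirectSum.toModule_lof]
        exact LinearMap.congr_fun ((φ i).isIntertwining' g) x }
  refine ⟨{ toLinearMap := res
            invFun := ext'
            left_inv := fun T => IntertwiningMap.ext (DirectSum.linearMap_ext k fun i => LinearMap.ext fun x => ?_)
            right_inv := fun φ => funext fun i => IntertwiningMap.ext (LinearMap.ext fun x => ?_) }, fun T i x => rfl⟩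
  · change DirectSum.toModule k ι N (fun i => (res T i).toLinearMap) (DirectSum.lof k ι M i x) = T (DirectSum.lof k ι M i x)
    rw [DirectSum.toModule_lof]
    rfl
  · change DirectSum.toModule k ι N (fun i => (φ i).toLinearMap) (DirectSum.lof k ι M i x) = φ i x
    rw [DirectSum.toModule_lof]
    rfl

/-- `Hom_G(⨁ᵢ Vᵢ, ρ)` is a finite `k`-module when the family is finite and every `Hom_G(Vᵢ, ρ)` is. [cite: SchneiderStuhler1997, §III.4] -/
theorem finite_intertwiningMap_directSum [Finite ι] (V : ∀ i, Representation k G (M i)) (ρ : Representation k G N)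
    [∀ i, Module.Finite k ((V i).IntertwiningMap ρ)] : Module.Finite k ((Representation.directSum V).IntertwiningMap ρ) := by
  classical
  obtain ⟨e, -⟩ := exists_linearEquiv_intertwiningMap_directSum_pi V ρ
  exact Module.Finite.equiv e.symm

end DirectSumSource

section DirectSumSourceField

variable {k G : Type*} [Field k] [Group G] {ι : Type*} {M : ι → Type*} [∀ i, AddCommGroup (M i)] [∀ i, Module k (M i)]
  {N : Type*} [AddCommGroup N] [Module k N]

/-- **`dim Hom_G(⨁ᵢ Vᵢ, ρ) = Σᵢ dim Hom_G(Vᵢ, ρ)`** for a finite family with finite-dimensional Hom-spaces (`k` a field). [cite: SchneiderStuhler1997, §III.4] -/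
theorem finrank_intertwiningMap_directSum_eq_sum [Fintype ι] (V : ∀ i, Representation k G (M i)) (ρ : Representation k G N)
    [∀ i, FiniteDimensional k ((V i).IntertwiningMap ρ)] :
    Module.finrank k ((Representation.directSum V).IntertwiningMap ρ) = ∑ i, Module.finrank k ((V i).IntertwiningMap ρ) := by
  classical
  obtain ⟨e, -⟩ := exists_linearEquiv_intertwiningMap_directSum_pi V ρ
  rw [e.finrank_eq, Module.finrank_pi_fintype]

end DirectSumSourceField

/-! ## §2 The dimension form of Frobenius reciprocity for compact induction -/

section CIndFinrank

variable {k G W V : Type*} [CommRing k] [Group G] [TopologicalSpace G] [IsTopologicalGroup G] [AddCommGroup W] [Module k W] [AddCommGroup V] [Module k V]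
  (H : Subgroup G) (σ : Representation k H W) (π : Representation k G V)

/-- **`finrank k Hom_G(c-Ind_H^G σ, π) = finrank k Hom_H(σ, π|_H)`** (`H` open, `σ` smooth): the dimension form of ★ C-IND FROBENIUS `exists_linearEquiv_intertwiningMap_cIndRep`.
[cite: BushnellHenniart2006, §2.5 Proposition] [cite: Bump1997, Exercise 4.5.5] -/
theorem finrank_intertwiningMap_cIndRep_eq (hH : IsOpen (H : Set G)) (hσ : σ.IsSmooth) :
    Module.finrank k ((cIndRep H σ).IntertwiningMap π) = Module.finrank k (σ.IntertwiningMap (π.comp H.subtype)) := by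
  obtain ⟨e, -⟩ := Literature.NumberTheory.Automorphic.exists_linearEquiv_intertwiningMap_cIndRep H σ π hH hσ
  exact e.finrank_eq

/-- `Hom_G(c-Ind_H^G σ, π)` is a finite `k`-module iff `Hom_H(σ, π|_H)` is (`H` open, `σ` smooth). [cite: BushnellHenniart2006, §2.5 Proposition] -/
theorem finite_intertwiningMap_cIndRep_iff (hH : IsOpen (H : Set G)) (hσ : σ.IsSmooth) :
    Module.Finite k ((cIndRep H σ).IntertwiningMap π) ↔ Module.Finite k (σ.IntertwiningMap (π.comp H.subtype)) := by
  obtain ⟨e, -⟩ := Literature.NumberTheory.Automorphic.exists_linearEquiv_intertwiningMap_cIndRep H σ π hH hσ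
  exact ⟨fun _ => Module.Finite.equiv e, fun _ => Module.Finite.equiv e.symm⟩

end CIndFinrank

/-! ## §3 A direct sum of compact inductions -/

section CIndFamily

variable {k G V : Type*} [CommRing k] [Group G] [TopologicalSpace G] [IsTopologicalGroup G] [AddCommGroup V] [Module k V]
  {ι : Type*} {W : ι → Type*} [∀ i, AddCommGroup (W i)] [∀ i, Module k (W i)]
  (P : ι → Subgroup G) (τ : ∀ i, Representation k (P i) (W i)) (ρ : Representation k G V)

/-- **`Hom_G(⨁ᵢ c-Ind_{Pᵢ}^G τᵢ, ρ) ≃ₗ[k] Πᵢ Hom_{Pᵢ}(τᵢ, ρ|_{Pᵢ})`** (`Pᵢ` open, `τᵢ` smooth): §1 followed by ★ C-IND FROBENIUS summand by summand.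
[cite: SchneiderStuhler1997, §III.4] [cite: BushnellHenniart2006, §2.5 Proposition] -/
theorem nonempty_intertwiningMap_directSum_cIndRep_linearEquiv_pi (hP : ∀ i, IsOpen (P i : Set G)) (hτ : ∀ i, (τ i).IsSmooth) :
    Nonempty ((Representation.directSum fun i => cIndRep (P i) (τ i)).IntertwiningMap ρ ≃ₗ[k] (Π i, (τ i).IntertwiningMap (ρ.comp (P i).subtype))) := by
  classical
  obtain ⟨e, -⟩ := exists_linearEquiv_intertwiningMap_directSum_pi (fun i => cIndRep (P i) (τ i)) ρ
  choose f _hf using fun i => Literature.NumberTheory.Automorphic.exists_linearEquiv_intertwiningMap_cIndRep (P i) (τ i) ρ (hP i) (hτ i)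
  exact ⟨e.trans (LinearEquiv.piCongrRight f)⟩

/-- `Hom_G(⨁ᵢ c-Ind_{Pᵢ}^G τᵢ, ρ)` is a finite `k`-module when the family is finite and every `Hom_{Pᵢ}(τᵢ, ρ|_{Pᵢ})` is. [cite: SchneiderStuhler1997, §III.4] -/
theorem finite_intertwiningMap_directSum_cIndRep [Finite ι] (hP : ∀ i, IsOpen (P i : Set G)) (hτ : ∀ i, (τ i).IsSmooth)
    [∀ i, Module.Finite k ((τ i).IntertwiningMap (ρ.comp (P i).subtype))] :
    Module.Finite k ((Representation.directSum fun i => cIndRep (P i) (τ i)).IntertwiningMap ρ) := by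
  obtain ⟨e⟩ := nonempty_intertwiningMap_directSum_cIndRep_linearEquiv_pi P τ ρ hP hτ
  exact Module.Finite.equiv e.symm

end CIndFamily

section CIndFamilyField

variable {k G V : Type*} [Field k] [Group G] [TopologicalSpace G] [IsTopologicalGroup G] [AddCommGroup V] [Module k V]
  {ι : Type*} {W : ι → Type*} [∀ i, AddCommGroup (W i)] [∀ i, Module k (W i)]
  (P : ι → Subgroup G) (τ : ∀ i, Representation k (P i) (W i)) (ρ : Representation k G V)

/-- **`dim Hom_G(⨁ᵢ c-Ind_{Pᵢ}^G τᵢ, ρ) = Σᵢ dim Hom_{Pᵢ}(τᵢ, ρ|_{Pᵢ})`** (`k` a field, `ι` finite, `Pᵢ` open, `τᵢ` smooth, the local Hom-spaces finite-dimensional).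
[cite: SchneiderStuhler1997, §III.4] [cite: BushnellHenniart2006, §2.5 Proposition] -/
theorem finrank_intertwiningMap_directSum_cIndRep_eq_sum [Fintype ι] (hP : ∀ i, IsOpen (P i : Set G)) (hτ : ∀ i, (τ i).IsSmooth)
    [∀ i, FiniteDimensional k ((τ i).IntertwiningMap (ρ.comp (P i).subtype))] :
    Module.finrank k ((Representation.directSum fun i => cIndRep (P i) (τ i)).IntertwiningMap ρ) =
      ∑ i, Module.finrank k ((τ i).IntertwiningMap (ρ.comp (P i).subtype)) := by
  obtain ⟨e⟩ := nonempty_intertwiningMap_directSum_cIndRep_linearEquiv_pi P τ ρ hP hτ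
  rw [e.finrank_eq, Module.finrank_pi_fintype]

/-! ## §4 The (SS-E) second equality: regrouping the alternating sum by degree -/

/-- **THE (SS-E) SECOND EQUALITY `Σ_{i ∈ s} (−1)^{dᵢ} dim Hom_{Pᵢ}(τᵢ, ρ|_{Pᵢ}) = Σ_{q ∈ d(s)} (−1)^q dim Hom_G(C_q, ρ)`** with the `q`-chains
`C_q := ⨁_{i ∈ s, dᵢ = q} c-Ind_{Pᵢ}^G τᵢ` (Mathlib `Representation.directSum` over `↥(s.filter (d · = q))`), for a finite family `i ∈ s` of OPEN subgroups `Pᵢ` carrying SMOOTH `τᵢ`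
with finite-dimensional `Hom_{Pᵢ}(τᵢ, ρ|_{Pᵢ})`, valued in any commutative ring `R` (cast the dimensions).  Summand by summand this is Frobenius reciprocity for compact induction (§3);
the regrouping is `Finset.sum_fiberwise`. [cite: SchneiderStuhler1997, §III.4] -/
theorem alternatingSum_finrank_intertwiningMap_eq_sum_directSum_cIndRep {R : Type*} [CommRing R] [DecidableEq ι] (s : Finset ι) (d : ι → ℕ)
    (hP : ∀ i ∈ s, IsOpen (P i : Set G)) (hτ : ∀ i ∈ s, (τ i).IsSmooth)
    [∀ i, FiniteDimensional k ((τ i).IntertwiningMap (ρ.comp (P i).subtype))] :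
    ∑ i ∈ s, (-1 : R) ^ d i * (Module.finrank k ((τ i).IntertwiningMap (ρ.comp (P i).subtype)) : R) =
      ∑ q ∈ s.image d, (-1 : R) ^ q *
        (Module.finrank k ((Representation.directSum fun i : ↥(s.filter fun i => d i = q) => cIndRep (P i) (τ i)).IntertwiningMap ρ) : R) := by
  -- each `q`-chain space: Frobenius summand by summand
  have hq : ∀ q, Module.finrank k ((Representation.directSum fun i : ↥(s.filter fun i => d i = q) => cIndRep (P i) (τ i)).IntertwiningMap ρ) =
      ∑ i ∈ s.filter (fun i => d i = q), Module.finrank k ((τ i).IntertwiningMap (ρ.comp (P i).subtype)) := by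
    intro q
    rw [finrank_intertwiningMap_directSum_cIndRep_eq_sum (fun i : ↥(s.filter fun i => d i = q) => P i) (fun i => τ i) ρ
      (fun i => hP i (Finset.mem_filter.1 i.2).1) (fun i => hτ i (Finset.mem_filter.1 i.2).1)]
    exact Finset.sum_coe_sort (s.filter fun i => d i = q) (fun i => Module.finrank k ((τ i).IntertwiningMap (ρ.comp (P i).subtype)))
  simp_rw [hq, Nat.cast_sum, Finset.mul_sum]
  rw [← Finset.sum_fiberwise_of_maps_to (g := d) (fun i hi => Finset.mem_image_of_mem d hi)]
  refine Finset.sum_congr rfl fun q _ => Finset.sum_congr rfl fun i hi => ?_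
  rw [(Finset.mem_filter.1 hi).2]

/-- **The same with the total (unsigned) count**: `Σ_{i ∈ s} dim Hom_{Pᵢ}(τᵢ, ρ|_{Pᵢ}) = dim Hom_G(⨁_{i ∈ s} c-Ind_{Pᵢ}^G τᵢ, ρ)`. [cite: SchneiderStuhler1997, §III.4] -/
theorem sum_finrank_intertwiningMap_eq_finrank_directSum_cIndRep (s : Finset ι) (hP : ∀ i ∈ s, IsOpen (P i : Set G)) (hτ : ∀ i ∈ s, (τ i).IsSmooth)
    [∀ i, FiniteDimensional k ((τ i).IntertwiningMap (ρ.comp (P i).subtype))] :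
    ∑ i ∈ s, Module.finrank k ((τ i).IntertwiningMap (ρ.comp (P i).subtype)) =
      Module.finrank k ((Representation.directSum fun i : ↥s => cIndRep (P i) (τ i)).IntertwiningMap ρ) := by
  rw [finrank_intertwiningMap_directSum_cIndRep_eq_sum (fun i : ↥s => P i) (fun i => τ i) ρ (fun i => hP i i.2) (fun i => hτ i i.2)]
  exact (Finset.sum_coe_sort s (fun i => Module.finrank k ((τ i).IntertwiningMap (ρ.comp (P i).subtype)))).symm

end CIndFamilyField

end Representation

end
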